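import Literature.Algebra.EuclideanLattices.RegevQuantumPartStates
import Literature.Computability.QuantumComplexity.RevArith
import HarnessLib

/-!
# Regev 2009, Lemma 3.14 (machine form), III: the Fourier stage and the measured law

Topic `Algebra/EuclideanLattices` (family `pqc`), sequel of `RegevQuantumPartStates.lean`. After the
erasure the machine applies the `m`-fold quantum Fourier transform to the coefficient registers `S`
(`QFTQubitsTensor.multiQFT`; Regev 2009, Lemma 3.14: "We now apply the quantum Fourier transform on
`ℤ_R^n`") up to an `ℓ²` error `ε_F` (`ImplOn` of `ApproxImplementation.lean`: the rotations are realised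
by Clifford+`T` gadgets), measures, reads `t ∈ ℤ_Rᵐ` off the blocks `S` (`readS`, reversed bit order as in
`QFTQubits.lean`) and decodes `t ↦ dec t`. This file turns the state estimates of parts I–II and the
branchwise closeness of `RegevBranchState.lean` into the measured law:

* `bitsEquiv κ : (Fin κ → Bool) ≃ ZMod (2^κ)` (`t ↦ tVal t`), `readS`, `readS_writeAll`;
* `multiQFT_mulVec_basisState_labB` — on a clean label the ideal transform produces the column `s` of
  `QFTZMod.qftMatrix (Fin m) (2^κ)` over the labels `(base y)[S ↦ T]`; the event isometry
  `sum_filter_normSq_sum_smul_basisState`;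
* `psiTilde`, `gBranch` — the branch amplitudes as a unit vector `ψ̃(s, y) = ψ_y(s)/Z′` on `ℤ_Rᵐ × y(Box)`
  with the unit weight vector `g(y) = ‖ψ_y‖/Z′`, **`prob_ideal_eq`** — the ideal probability of the event
  `{dec t ∈ A}` IS `Σ_{(t,y): dec t ∈ A} |((F ⊗ 1)ψ̃)(t,y)|²`, and **`l2_psiTilde_sub_le`** —
  `‖ψ̃ − ϑ̂₁ ⊗ g‖₂ ≤ η₀ = √(2(δ + b₁ⁿ + 4⁻ⁿ)) + 2·2⁻ⁿ` (branch by branch,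
  `l2_normalize_branchVec_sub_normalize_thetaOne_le`);
* **`QPart.law_bound`** — for the actual final state `M_F (M_cl Ψ_GR)` of a machine whose Gaussian stage is
  within `ε₁` of the box Gaussian, whose classical stage `M_cl` is a unitary basis map along `κc`, and
  whose Fourier stage `M_F` implements `multiQFT S` up to `ε_F` on a support containing the labels:
  `|Pr[dec(readS) ∈ A] − D_{L,1/√2}(A)| ≤ 2(ε₁ + ε_F + 8C) + 2η₀ + 9·2⁻ⁿ`
  (`Regev2009.lemma_3_14_ideal_aux` on the ideal state; BBBV for the actual one), and `law_bound_of_basis`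
  (the same from the data `(L, (Lⱼ), R)`, `Λ = L*/R`, as `lemma_3_14_ideal_of_basis`).

Everything here is proved; definitions have bodies; no named fact is introduced.

## References

* O. Regev, *On lattices, learning with errors, random linear codes, and cryptography*, J. ACM 56
  (2009), art. 34; arXiv:2401.03703, Lemma 3.12, Claim 3.13, Lemma 3.14 [Regev2009].
* C. H. Bennett, E. Bernstein, G. Brassard, U. Vazirani, SIAM J. Comput. 26 (1997), Thm. 3.1
  [BennettBernsteinBrassardVazirani1997].
* M. A. Nielsen, I. L. Chuang, *Quantum Computation and Quantum Information*, CUP 2010, §5.1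
  [NielsenChuang2010].
-/

noncomputable section

open Module Metric Finset _root_.Matrix
open scoped Real InnerProductSpace ENNReal Kronecker

namespace Literature.Algebra.EuclideanLattices

namespace Regev2009

namespace QPart

open Literature.Computability.Cryptography Literature.Computability.QuantumComplexity
  Literature.Computability.QuantumComplexity.QState Literature.Computability.QuantumComplexity.QFTQubits

/-! ### Bits and numerals -/

section Bits

variable {κ : ℕ}

/-- `tVal` is `Nat.ofBits`. [folklore] -/
theorem tVal_eq_ofBits (b : Fin κ → Bool) : tVal b = Nat.ofBits b := by
  rw [ofBits_eq_sum]; unfold tVal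
  refine sum_congr rfl fun i _ => ?_
  cases b i <;> simp

/-- `tVal b < 2^κ`. [folklore] -/
theorem tVal_lt (b : Fin κ → Bool) : tVal b < 2 ^ κ := by rw [tVal_eq_ofBits]; exact Nat.ofBits_lt_two_pow _

/-- `tVal` is injective. [folklore] -/
theorem tVal_injective : Function.Injective (tVal : (Fin κ → Bool) → ℕ) := fun b b' h => by
  funext j
  have := congrArg (fun v => Nat.testBit v j) h
  simpa [tVal_eq_ofBits, Nat.testBit_ofBits_lt _ _ j.2] using this

/-- **The bijection `(Fin κ → Bool) ≃ ℤ_{2^κ}`**, `b ↦ tVal b` (the output numeral of `QFTQubits`).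
[cite: NielsenChuang2010, §5.1] -/
def bitsEquiv (κ : ℕ) : (Fin κ → Bool) ≃ ZMod (2 ^ κ) :=
  Equiv.ofBijective (fun b => ((tVal b : ℕ) : ZMod (2 ^ κ))) (by
    haveI : NeZero (2 ^ κ) := ⟨pow_ne_zero _ two_ne_zero⟩
    rw [Fintype.bijective_iff_injective_and_card]
    refine ⟨fun b b' h => tVal_injective ?_, by simp [ZMod.card]⟩
    have h' := congrArg ZMod.val h
    simp only [ZMod.val_natCast, Nat.mod_eq_of_lt (tVal_lt b), Nat.mod_eq_of_lt (tVal_lt b')] at h'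
    exact h')

/-- Value of `bitsEquiv`. [folklore] -/
theorem bitsEquiv_apply (b : Fin κ → Bool) : bitsEquiv κ b = ((tVal b : ℕ) : ZMod (2 ^ κ)) := rfl

end Bits

/-! ### Reading the coefficient registers; the ideal transform on a clean label -/

variable {V : Type*} {W m κ : ℕ}

/-- **Reading `t ∈ ℤ_Rᵐ` off the blocks `S`** (each block in the reversed bit order of the Fourier output).
[cite: Regev2009, Lemma 3.14 (proof: "measure … obtain t")] -/
def readS (S : Fin m → (Fin κ ↪ Fin W)) (z : QReg W) : Fin m → ZMod (2 ^ κ) := fun i => bitsEquiv κ fun j => z (S i j)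

/-- Reading a written label. [folklore] -/
theorem readS_writeAll {S : Fin m → (Fin κ ↪ Fin W)} (hdis : ∀ i i', i ≠ i' → Disjoint (Set.range (S i)) (Set.range (S i')))
    (c : QReg W) (T : Fin m → Fin κ → Bool) : readS S (writeAll S c T) = fun i => bitsEquiv κ (T i) := by
  funext i; unfold readS; congr 1; funext j; rw [writeAll_apply_ws hdis]

variable {S : Fin m → (Fin κ ↪ Fin W)} {base : V → QReg W} {enc : ZMod (2 ^ κ) → Fin κ → Bool}
  {Box : Finset V} {yOf : V → V} {sOf : V → Fin m → ZMod (2 ^ κ)} {Good : V → Prop}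
  {lab₀ : V → QReg W} {κc : QReg W → QReg W}

/-- **The ideal transform on a clean label**: `multiQFT |labB y s⟩ = Σ_T F_{t(T), s} |(base y)[S ↦ T]⟩`.
[cite: Regev2009, Lemma 3.14 (proof)] [cite: NielsenChuang2010, §5.1 eq. (5.2)] -/
theorem multiQFT_mulVec_basisState_labB (hR : RegHyps S base enc Box yOf sOf Good lab₀ κc) (y : V) (s : Fin m → ZMod (2 ^ κ)) :
    multiQFT S *ᵥ basisState (labB S base enc y s) = ∑ T : Fin m → Fin κ → Bool,
      QFTZMod.qftMatrix (Fin m) (2 ^ κ) (fun i => bitsEquiv κ (T i)) s • basisState (writeAll S (base y) T) := by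
  haveI : NeZero (2 ^ κ) := ⟨pow_ne_zero _ two_ne_zero⟩
  rw [multiQFT_mulVec_basisState_eq_qftMatrix hR.hdis]
  refine sum_congr rfl fun T _ => ?_
  have hs : (fun i => ((uVal (S i) (labB S base enc y s) : ℕ) : ZMod (2 ^ κ))) = s := funext fun i => uVal_labB hR y s i
  rw [hs]
  unfold labB
  rw [writeAll_writeAll hR.hdis]
  rfl

/-- **Event isometry**: for injective `f`, the weight of an event on `Σᵢ aᵢ |f i⟩` is `Σ_{i : f i ∈ E} |aᵢ|²`.
[cite: NielsenChuang2010, §2.2.5] -/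
theorem sum_filter_normSq_sum_smul_basisState {I : Type*} [Fintype I] {f : I → QReg W} (hf : Function.Injective f)
    (a : I → ℂ) (E : QReg W → Prop) [DecidablePred E] :
    ∑ z ∈ univ.filter E, ‖(∑ i, a i • basisState (f i)) z‖ ^ 2 = ∑ i ∈ univ.filter (fun i => E (f i)), ‖a i‖ ^ 2 := by
  classical
  have happ : ∀ z : QReg W, (∑ i, a i • basisState (f i)) z = if h : z ∈ Set.range f then a h.choose else 0 := by
    intro z
    rw [Finset.sum_apply]
    simp only [Pi.smul_apply, basisState_apply, smul_eq_mul, mul_ite, mul_one, mul_zero]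
    split_ifs with h
    · have hspec := h.choose_spec
      rw [Finset.sum_eq_single h.choose]
      · rw [if_pos hspec.symm]
      · intro i _ hi
        rw [if_neg]
        intro e; apply hi
        exact hf (by rw [← e, hspec])
      · simp
    · exact Finset.sum_eq_zero fun i _ => if_neg fun e => h ⟨i, e.symm⟩
  -- the range as an image
  have hsub : ∑ z ∈ univ.filter E, ‖(∑ i, a i • basisState (f i)) z‖ ^ 2 =
      ∑ z ∈ (univ.image f).filter E, ‖(∑ i, a i • basisState (f i)) z‖ ^ 2 := by
    symm
    refine sum_subset (fun z hz => mem_filter.2 ⟨mem_univ _, (mem_filter.1 hz).2⟩) fun z hz hz' => ?_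
    have hzr : z ∉ Set.range f := by
      rintro ⟨i, rfl⟩; exact hz' (mem_filter.2 ⟨mem_image_of_mem _ (mem_univ _), (mem_filter.1 hz).2⟩)
    rw [happ, dif_neg hzr]; simp
  rw [hsub, filter_image, sum_image fun i _ i' _ h => hf h]
  refine sum_congr rfl fun i _ => ?_
  have h : f i ∈ Set.range f := ⟨i, rfl⟩
  rw [happ, dif_pos h, hf h.choose_spec]

/-! ### The branch amplitudes as a vector on `ℤ_Rᵐ × y(Box)` -/

variable [NormedAddCommGroup V] [InnerProductSpace ℝ V] [DecidableEq V]

/-- **The branch norm** `Z′ = (Σ_{y ∈ y(Box)} Σ_s ψ_y(s)²)^{1/2}`. [cite: Regev2009, Lemma 3.12 (proof)] -/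
def zBranch (κ : ℕ) (Λ : Submodule ℤ V) (e : Basis (Fin m) ℤ Λ) (Box : Finset V) (yOf : V → V) : ℝ :=
  Real.sqrt (∑ y ∈ Box.image yOf, ∑ s : Fin m → ZMod (2 ^ κ), branchAmp Λ e (2 ^ κ) Box y s ^ 2)

/-- **The normalised branch amplitudes** `ψ̃(s, y) = ψ_y(s)/Z′` on `ℤ_Rᵐ × y(Box)`. [cite: Regev2009, Lemma 3.14 (proof)] -/
def psiTilde (κ : ℕ) (Λ : Submodule ℤ V) (e : Basis (Fin m) ℤ Λ) (Box : Finset V) (yOf : V → V) :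
    (Fin m → ZMod (2 ^ κ)) × (Box.image yOf) → ℂ := fun p =>
  (((branchAmp Λ e (2 ^ κ) Box (p.2 : V) p.1 / zBranch κ Λ e Box yOf : ℝ)) : ℂ)

/-- **The branch weights** `g(y) = ‖ψ_y‖/Z′` (a unit vector on `y(Box)`). [cite: Regev2009, Lemma 3.14 (proof)] -/
def gBranch (κ : ℕ) (Λ : Submodule ℤ V) (e : Basis (Fin m) ℤ Λ) (Box : Finset V) (yOf : V → V) : (Box.image yOf) → ℂ :=
  fun y => (((l2 (branchVec Λ e (2 ^ κ) Box (y : V)) / zBranch κ Λ e Box yOf : ℝ)) : ℂ)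

variable {Λ : Submodule ℤ V} {e : Basis (Fin m) ℤ Λ}

omit [DecidableEq V] in
/-- `‖ψ_y‖² = Σ_s ψ_y(s)²`. [folklore] -/
theorem l2_branchVec_sq (y : V) : l2 (branchVec Λ e (2 ^ κ) Box y) ^ 2 = ∑ s : Fin m → ZMod (2 ^ κ), branchAmp Λ e (2 ^ κ) Box y s ^ 2 := by
  rw [l2_sq]; refine sum_congr rfl fun s _ => ?_
  rw [branchVec, Complex.norm_real, Real.norm_eq_abs, sq_abs]

/-- `Z′² = Σ_{y ∈ y(Box)} ‖ψ_y‖²`. [folklore] -/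
theorem zBranch_sq : zBranch κ Λ e Box yOf ^ 2 = ∑ y ∈ Box.image yOf, l2 (branchVec Λ e (2 ^ κ) Box y) ^ 2 := by
  unfold zBranch
  rw [Real.sq_sqrt (sum_nonneg fun _ _ => sum_nonneg fun _ _ => sq_nonneg _)]
  exact sum_congr rfl fun y _ => (l2_branchVec_sq y).symm

/-- `g` is a unit vector (for `Z′ > 0`). [folklore] -/
theorem l2_gBranch (hZ' : 0 < zBranch κ Λ e Box yOf) : l2 (gBranch κ Λ e Box yOf) = 1 := by
  have h : l2 (gBranch κ Λ e Box yOf) ^ 2 = 1 := by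
    rw [l2_sq]
    unfold gBranch
    simp_rw [Complex.norm_real, Real.norm_eq_abs, sq_abs, div_pow]
    rw [← sum_div, sum_coe_sort (Box.image yOf) (fun y => l2 (branchVec Λ e (2 ^ κ) Box y) ^ 2), ← zBranch_sq,
      div_self (pow_ne_zero _ hZ'.ne')]
  have h0 : 0 ≤ l2 (gBranch κ Λ e Box yOf) := l2_nonneg _
  nlinarith [h, h0]

/-- `ψ̃` is a unit vector (for `Z′ > 0`). [folklore] -/
theorem l2_psiTilde (hZ' : 0 < zBranch κ Λ e Box yOf) : l2 (psiTilde κ Λ e Box yOf) = 1 := by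
  have h : l2 (psiTilde κ Λ e Box yOf) ^ 2 = 1 := by
    rw [l2_sq, Fintype.sum_prod_type, sum_comm]
    unfold psiTilde
    simp_rw [Complex.norm_real, Real.norm_eq_abs, sq_abs, div_pow]
    rw [show (∑ y : (Box.image yOf), ∑ s : Fin m → ZMod (2 ^ κ),
        branchAmp Λ e (2 ^ κ) Box (y : V) s ^ 2 / zBranch κ Λ e Box yOf ^ 2) =
        (∑ y : (Box.image yOf), l2 (branchVec Λ e (2 ^ κ) Box (y : V)) ^ 2) / zBranch κ Λ e Box yOf ^ 2 by
        rw [sum_div]; refine sum_congr rfl fun y _ => ?_; rw [← sum_div, l2_branchVec_sq],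
      sum_coe_sort (Box.image yOf) (fun y => l2 (branchVec Λ e (2 ^ κ) Box y) ^ 2), ← zBranch_sq,
      div_self (pow_ne_zero _ hZ'.ne')]
  have h0 : 0 ≤ l2 (psiTilde κ Λ e Box yOf) := l2_nonneg _
  nlinarith [h, h0]

/-- **`‖ψ̃ − ϑ̂₁ ⊗ g‖₂ ≤ η₀`** when every normalised branch vector of the box is within `η₀` of `ϑ̂₁`
(`ψ̃(·, y) = g(y) ψ̂_y`). [cite: Regev2009, Lemma 3.12 (proof), Lemma 3.14 (proof)] -/
theorem l2_psiTilde_sub_le [NeZero (2 ^ κ : ℕ)] (hZ' : 0 < zBranch κ Λ e Box yOf) {η₀ : ℝ} (hη₀ : 0 ≤ η₀)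
    (hne : ∀ y ∈ Box.image yOf, branchVec Λ e (2 ^ κ) Box y ≠ 0)
    (hbr : ∀ y ∈ Box.image yOf, l2 (normalize (branchVec Λ e (2 ^ κ) Box y) - normalize (thetaOne Λ e (2 ^ κ))) ≤ η₀) :
    l2 (psiTilde κ Λ e Box yOf - fun p : (Fin m → ZMod (2 ^ κ)) × (Box.image yOf) => normalize (thetaOne Λ e (2 ^ κ)) p.1 * gBranch κ Λ e Box yOf p.2) ≤ η₀ := by
  -- branchwise factorisation `ψ̃(s,y) − ϑ̂₁(s) g(y) = g(y) (ψ̂_y(s) − ϑ̂₁(s))`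
  have hfac : ∀ (y : (Box.image yOf)) (s : Fin m → ZMod (2 ^ κ)),
      psiTilde κ Λ e Box yOf (s, y) - normalize (thetaOne Λ e (2 ^ κ)) s * gBranch κ Λ e Box yOf y =
        gBranch κ Λ e Box yOf y * (normalize (branchVec Λ e (2 ^ κ) Box (y : V)) - normalize (thetaOne Λ e (2 ^ κ))) s := by
    intro y s
    have hl : l2 (branchVec Λ e (2 ^ κ) Box (y : V)) ≠ 0 := (l2_pos (hne y y.2)).ne'
    have hnorm : (normalize (branchVec Λ e (2 ^ κ) Box (y : V))) s =
        (((l2 (branchVec Λ e (2 ^ κ) Box (y : V)))⁻¹ : ℝ) : ℂ) * (branchAmp Λ e (2 ^ κ) Box (y : V) s : ℂ) := by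
      rw [QState.normalize, Pi.smul_apply, Complex.real_smul]; rfl
    rw [Pi.sub_apply, hnorm]
    unfold psiTilde gBranch
    rw [mul_sub]
    congr 1
    · have hl' : ((l2 (branchVec Λ e (2 ^ κ) Box (y : V)) : ℝ) : ℂ) ≠ 0 := Complex.ofReal_ne_zero.2 hl
      push_cast
      rw [div_mul_eq_mul_div, mul_inv_cancel_left₀ hl']
    · exact mul_comm _ _
  have hsq : l2 (psiTilde κ Λ e Box yOf - fun p : (Fin m → ZMod (2 ^ κ)) × (Box.image yOf) => normalize (thetaOne Λ e (2 ^ κ)) p.1 * gBranch κ Λ e Box yOf p.2) ^ 2 ≤ η₀ ^ 2 := by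
    have hpt : ∀ p : (Fin m → ZMod (2 ^ κ)) × (Box.image yOf),
        ‖(psiTilde κ Λ e Box yOf - fun p : (Fin m → ZMod (2 ^ κ)) × (Box.image yOf) => normalize (thetaOne Λ e (2 ^ κ)) p.1 * gBranch κ Λ e Box yOf p.2) p‖ ^ 2 =
          ‖gBranch κ Λ e Box yOf p.2‖ ^ 2 *
            ‖(normalize (branchVec Λ e (2 ^ κ) Box (p.2 : V)) - normalize (thetaOne Λ e (2 ^ κ))) p.1‖ ^ 2 := by
      rintro ⟨s, y⟩
      rw [Pi.sub_apply, hfac y s, norm_mul, mul_pow]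
    rw [l2_sq]
    simp only [hpt]
    rw [Fintype.sum_prod_type, sum_comm]
    calc ∑ y : (Box.image yOf), ∑ s : Fin m → ZMod (2 ^ κ), ‖gBranch κ Λ e Box yOf y‖ ^ 2 *
          ‖(normalize (branchVec Λ e (2 ^ κ) Box (y : V)) - normalize (thetaOne Λ e (2 ^ κ))) s‖ ^ 2
        = ∑ y : (Box.image yOf), ‖gBranch κ Λ e Box yOf y‖ ^ 2 *
            l2 (normalize (branchVec Λ e (2 ^ κ) Box (y : V)) - normalize (thetaOne Λ e (2 ^ κ))) ^ 2 := by
          refine sum_congr rfl fun y _ => ?_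
          rw [l2_sq, mul_sum]
      _ ≤ ∑ y : (Box.image yOf), ‖gBranch κ Λ e Box yOf y‖ ^ 2 * η₀ ^ 2 :=
          sum_le_sum fun y _ => mul_le_mul_of_nonneg_left (pow_le_pow_left₀ (l2_nonneg _) (hbr y y.2) 2) (sq_nonneg _)
      _ = η₀ ^ 2 := by rw [← sum_mul, ← l2_sq, l2_gBranch hZ', one_pow, one_mul]
  exact (pow_le_pow_iff_left₀ (l2_nonneg _) hη₀ two_ne_zero).1 hsq

/-! ### The ideal probability is the `(F ⊗ 1)ψ̃`-probability -/

omit [NormedAddCommGroup V] [InnerProductSpace ℝ V] [DecidableEq V] in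
/-- Entries of `(A ⊗ 1) v`. [folklore] -/
theorem kronecker_one_mulVec_apply {X Y : Type*} [Fintype X] [Fintype Y] [DecidableEq X] [DecidableEq Y] (A : Matrix X X ℂ)
    (v : X × Y → ℂ) (t : X) (y : Y) : ((A ⊗ₖ (1 : Matrix Y Y ℂ)) *ᵥ v) (t, y) = ∑ s, A t s * v (s, y) := by
  rw [Matrix.mulVec, dotProduct, Fintype.sum_prod_type]
  refine sum_congr rfl fun s _ => ?_
  simp only [Matrix.kroneckerMap_apply, Matrix.one_apply, mul_ite, mul_one, mul_zero, ite_mul, zero_mul]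
  rw [Finset.sum_ite_eq]
  simp

omit [NormedAddCommGroup V] [InnerProductSpace ℝ V] in
/-- The labels of the outputs are injective on `y(Box) × (Fin m → Fin κ → Bool)`. [folklore] -/
theorem out_injective (hR : RegHyps S base enc Box yOf sOf Good lab₀ κc) :
    Function.Injective fun p : (Box.image yOf) × (Fin m → Fin κ → Bool) => writeAll S (base (p.1 : V)) p.2 := by
  rintro ⟨⟨y, hy⟩, T⟩ ⟨⟨y', hy'⟩, T'⟩ h
  dsimp only at h
  obtain ⟨x, hx, rfl⟩ := mem_image.1 hy
  obtain ⟨x', hx', rfl⟩ := mem_image.1 hy'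
  have hyy : yOf x = yOf x' := by
    by_contra hne
    obtain ⟨q, hq, hneq⟩ := hR.base_sep x hx x' hx' hne
    apply hneq
    have := congrFun h q
    rwa [writeAll_apply_off _ _ hq, writeAll_apply_off _ _ hq] at this
  have hT : T = T' := by
    rw [hyy] at h
    exact writeAll_injective hR.hdis _ h
  subst hT
  simp only [Prod.mk.injEq, and_true]
  exact Subtype.ext hyy

/-- **The ideal final state** `Ω = multiQFT S (Φ′/‖Φ′‖)`. [cite: Regev2009, Lemma 3.14 (proof)] -/
def omegaState (Λ : Submodule ℤ V) (e : Basis (Fin m) ℤ Λ) (S : Fin m → (Fin κ ↪ Fin W)) (base : V → QReg W)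
    (enc : ZMod (2 ^ κ) → Fin κ → Bool) (Box : Finset V) (yOf : V → V) : QReg W → ℂ :=
  multiQFT S *ᵥ normalize (phiIdeal Λ e S base enc Box yOf)

/-- **The ideal final state as a superposition of the output labels**:
`Ω = Σ_{y, T} (Σ_s F_{t(T), s} ψ_y(s)/Z′) |(base y)[S ↦ T]⟩`. [cite: Regev2009, Lemma 3.14 (proof)] -/
theorem omegaState_eq (hR : RegHyps S base enc Box yOf sOf Good lab₀ κc) (hne : Box.Nonempty) (hZ' : 0 < zBranch κ Λ e Box yOf) :
    omegaState Λ e S base enc Box yOf =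
      ∑ p : (Box.image yOf) × (Fin m → Fin κ → Bool),
        (∑ s : Fin m → ZMod (2 ^ κ), QFTZMod.qftMatrix (Fin m) (2 ^ κ) (fun i => bitsEquiv κ (p.2 i)) s *
            psiTilde κ Λ e Box yOf (s, p.1)) • basisState (writeAll S (base (p.1 : V)) p.2) := by
  haveI : NeZero (2 ^ κ) := ⟨pow_ne_zero _ two_ne_zero⟩
  have hZ := zBox_pos hne
  have hnorm : l2 (phiIdeal Λ e S base enc Box yOf) = zBranch κ Λ e Box yOf / zBox Box := l2Norm_phiIdeal hR hne
  unfold omegaState QState.normalize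
  have hcoe : ∀ G : V → QReg W → ℂ, ∑ y ∈ Box.image yOf, G y = ∑ y : (Box.image yOf), G y :=
    fun G => (Finset.sum_coe_sort _ G).symm
  rw [hnorm, Matrix.mulVec_smul (multiQFT S) ((zBranch κ Λ e Box yOf / zBox Box)⁻¹) (phiIdeal Λ e S base enc Box yOf),
    phiIdeal, Matrix.mulVec_sum, smul_sum, hcoe]
  simp only [Fintype.sum_prod_type]
  apply Finset.sum_congr rfl
  intro y _
  rw [Matrix.mulVec_sum, smul_sum]
  -- expand the transform of each clean label and swap the sums
  have hstep : ∀ s : Fin m → ZMod (2 ^ κ),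
      (zBranch κ Λ e Box yOf / zBox Box)⁻¹ • (multiQFT S *ᵥ ((((branchAmp Λ e (2 ^ κ) Box (y : V) s / zBox Box : ℝ)) : ℂ) •
        basisState (labB S base enc (y : V) s))) =
      ∑ T : Fin m → Fin κ → Bool, (QFTZMod.qftMatrix (Fin m) (2 ^ κ) (fun i => bitsEquiv κ (T i)) s *
        psiTilde κ Λ e Box yOf (s, y)) • basisState (writeAll S (base (y : V)) T) := by
    intro s
    rw [Matrix.mulVec_smul, multiQFT_mulVec_basisState_labB hR, smul_sum, smul_sum]
    refine sum_congr rfl fun T _ => ?_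
    rw [smul_smul, ← smul_assoc, Complex.real_smul]
    congr 1
    unfold psiTilde
    have hZc : ((zBox Box : ℝ) : ℂ) ≠ 0 := Complex.ofReal_ne_zero.2 hZ.ne'
    have hZ'c : ((zBranch κ Λ e Box yOf : ℝ) : ℂ) ≠ 0 := Complex.ofReal_ne_zero.2 hZ'.ne'
    push_cast
    field_simp
  simp_rw [hstep]
  rw [sum_comm]
  refine sum_congr rfl fun T _ => ?_
  rw [← sum_smul]

open Classical in
/-- **The ideal probability of `{dec(readS) ∈ A}` is the `(F ⊗ 1)ψ̃`-probability of `{dec t ∈ A}`.**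
[cite: Regev2009, Lemma 3.14 (proof)] -/
theorem prob_ideal_eq (hR : RegHyps S base enc Box yOf sOf Good lab₀ κc) (hne : Box.Nonempty) (hZ' : 0 < zBranch κ Λ e Box yOf)
    (dec : (Fin m → ZMod (2 ^ κ)) → V) (A : Set V) :
    ∑ z ∈ univ.filter (fun z => dec (readS S z) ∈ A), ‖omegaState Λ e S base enc Box yOf z‖ ^ 2 =
      ∑ p ∈ univ.filter (fun p : (Fin m → ZMod (2 ^ κ)) × (Box.image yOf) => dec p.1 ∈ A),
        ‖((QFTZMod.qftMatrix (Fin m) (2 ^ κ) ⊗ₖ (1 : Matrix (Box.image yOf) (Box.image yOf) ℂ)) *ᵥ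
          psiTilde κ Λ e Box yOf) p‖ ^ 2 := by
  haveI : NeZero (2 ^ κ) := ⟨pow_ne_zero _ two_ne_zero⟩
  rw [omegaState_eq hR hne hZ', sum_filter_normSq_sum_smul_basisState (out_injective hR)]
  -- the event read off an output label
  have hread : ∀ p : (Box.image yOf) × (Fin m → Fin κ → Bool),
      readS S (writeAll S (base (p.1 : V)) p.2) = fun i => bitsEquiv κ (p.2 i) := fun p => readS_writeAll hR.hdis _ _
  simp_rw [hread]
  -- reindex `(y, T) ↦ (t(T), y)`
  let eq : (Box.image yOf) × (Fin m → Fin κ → Bool) ≃ (Fin m → ZMod (2 ^ κ)) × (Box.image yOf) :=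
    (Equiv.prodComm _ _).trans (Equiv.prodCongr (Equiv.piCongrRight fun _ => bitsEquiv κ) (Equiv.refl _))
  rw [sum_filter, sum_filter]
  refine Fintype.sum_equiv eq _ _ fun p => ?_
  have h1 : (eq p).1 = fun i => bitsEquiv κ (p.2 i) := rfl
  have h2 : ((QFTZMod.qftMatrix (Fin m) (2 ^ κ) ⊗ₖ (1 : Matrix (Box.image yOf) (Box.image yOf) ℂ)) *ᵥ psiTilde κ Λ e Box yOf) (eq p) =
      ∑ s, QFTZMod.qftMatrix (Fin m) (2 ^ κ) (fun i => bitsEquiv κ (p.2 i)) s * psiTilde κ Λ e Box yOf (s, p.1) :=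
    kronecker_one_mulVec_apply _ _ _ _
  simp only [h1, h2]

/-! ### The measured law -/

open Classical in
/-- **Regev 2009, Lemma 3.14, machine form (the law of the quantum part).** Let the machine's Gaussian
stage output a unit vector `Ψ_GR` within `ε₁` of the box Gaussian `Z⁻¹ Σ_{x ∈ Box} ρ(x)|lab₀ x⟩`, let its
classical stage `M_cl` be a unitary basis map along `κc` satisfying the fibre and register hypotheses
(`FibreHyps`, `RegHyps`), let its Fourier stage `M_F` (unitary) implement `multiQFT S` up to `ε_F` on a
support containing all final labels, and let the lattice data satisfy the hypotheses of
`RegevBranchState` on every branch (`λ₁(RΛ) > 2√n`, `‖y‖ ≤ Y`, `δ = π(2√nY + Y²) < 1`, box covering the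
short shifts, box spread `B`, `C = e^{2πBY}2⁻ⁿ/κ ≤ 1/2`) together with `λ₁(RL) > 2√n`
(`ShortVectorsTrivial`) and a decoder `dec` (`IsDecoder`). Then for every event `A`:

  `|Pr_{z ∼ |M_F M_cl Ψ_GR|²}[dec (readS z) ∈ A] − D_{L,1/√2}(A)| ≤ 2(ε₁ + ε_F + 8C) + 2η₀ + 9·2⁻ⁿ`,

`η₀ = √(2(δ + b₁ⁿ + 4⁻ⁿ)) + 2·2⁻ⁿ`, `L = primalLattice Λ e R`. [cite: Regev2009, Lemma 3.14] -/
theorem law_bound [FiniteDimensional ℝ V] [MeasurableSpace V] [BorelSpace V] [Nontrivial V]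
    {Λ : Submodule ℤ V} [DiscreteTopology Λ] [IsZLattice ℝ Λ] {e : Basis (Fin m) ℤ Λ} [NeZero (2 ^ κ : ℕ)]
    [DecidablePred Good]
    (hH : FibreHyps Λ e (2 ^ κ) Box yOf sOf Good) (hR : RegHyps S base enc Box yOf sOf Good lab₀ κc) (hne : Box.Nonempty)
    -- lattice hypotheses
    (hsvΛ : ∀ z ∈ scaledLattice Λ (2 ^ κ), ‖z‖ < 2 * Real.sqrt (finrank ℝ V) → z = 0)
    (hsv : ShortVectorsTrivial Λ e (2 ^ κ)) {dec : (Fin m → ZMod (2 ^ κ)) → V} (hdec : IsDecoder Λ e (2 ^ κ) dec)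
    {B Y C : ℝ} (hBox : ∀ x ∈ Box, BoxCoversShort Λ Box (yOf x)) (hY : ∀ x ∈ Box, ‖yOf x‖ ≤ Y)
    (hB : ∀ x ∈ Box, ∀ x' ∈ Box, ‖x - yOf x'‖ ≤ B) (hδ : π * (2 * Real.sqrt (finrank ℝ V) * Y + Y ^ 2) < 1)
    (hC : Real.exp (2 * π * B * Y) * (2⁻¹ : ℝ) ^ finrank ℝ V ≤
      C * ((1 - π * (2 * Real.sqrt (finrank ℝ V) * Y + Y ^ 2)) * (1 - banaConst ^ finrank ℝ V) * (1 - (4⁻¹ : ℝ) ^ finrank ℝ V)))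
    (hC2 : C ≤ 1 / 2) (hC0 : 0 ≤ C)
    -- machine hypotheses
    {ΨGR : QReg W → ℂ} (hΨGR : l2Norm ΨGR = 1) {ε₁ : ℝ}
    (hε₁ : l2Norm (ΨGR - embed Box (fun x => (((gaussianFunction 1 x / zBox Box : ℝ)) : ℂ)) lab₀) ≤ ε₁)
    {Mcl : Matrix (QReg W) (QReg W) ℂ} (hMcl : IsBasisMap Mcl κc) (hMclU : Mcl ∈ Matrix.unitaryGroup (QReg W) ℂ)
    {MF : Matrix (QReg W) (QReg W) ℂ} (hMFU : MF ∈ Matrix.unitaryGroup (QReg W) ℂ) {PF : Set (QReg W)} {εF : ℝ}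
    (hMF : ImplOn PF MF (multiQFT S) εF) (hPF : ∀ x ∈ Box, κc (lab₀ x) ∈ PF)
    (A : Set V) :
    |∑ z ∈ univ.filter (fun z => dec (readS S z) ∈ A), ‖(MF *ᵥ (Mcl *ᵥ ΨGR)) z‖ ^ 2 -
        ((discreteGaussian (primalLattice Λ e (2 ^ κ)) (Real.sqrt 2)⁻¹ 0).toOuterMeasure
          {x : primalLattice Λ e (2 ^ κ) | (x : V) ∈ A}).toReal| ≤
      2 * (ε₁ + εF + 8 * C) +
        2 * (Real.sqrt (2 * (π * (2 * Real.sqrt (finrank ℝ V) * Y + Y ^ 2) + banaConst ^ finrank ℝ V + 4⁻¹ ^ finrank ℝ V)) +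
          2 * (2⁻¹ : ℝ) ^ finrank ℝ V) + 9 * (2⁻¹ : ℝ) ^ finrank ℝ V := by
  set n := finrank ℝ V with hn
  set η₀ : ℝ := Real.sqrt (2 * (π * (2 * Real.sqrt n * Y + Y ^ 2) + banaConst ^ n + 4⁻¹ ^ n)) + 2 * (2⁻¹ : ℝ) ^ n with hη₀
  have hη₀0 : 0 ≤ η₀ := by positivity
  have hZ := zBox_pos hne
  -- the two states and their distance
  set Φ : QReg W → ℂ := phiState Box lab₀ κc with hΦ
  set Ψ : QReg W → ℂ := phiIdeal Λ e S base enc Box yOf with hΨ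
  set Ω : QReg W → ℂ := omegaState Λ e S base enc Box yOf with hΩ
  obtain ⟨hd, hZle, hZ'le⟩ := l2Norm_phiState_sub_phiIdeal_le_of_small hH hR hne hsvΛ hBox hY hB hδ hC hC2 hC0
  rw [← hΦ, ← hΨ] at hd
  have hZ'pos : 0 < zBranch κ Λ e Box yOf := lt_of_lt_of_le hZ hZle
  have hΦunit : l2Norm Φ = 1 := l2Norm_phiState hR hne
  have hΨnorm : l2Norm Ψ = zBranch κ Λ e Box yOf / zBox Box := l2Norm_phiIdeal hR hne
  have hΨne : Ψ ≠ 0 := fun h0 => by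
    have h1 : l2Norm Ψ = 0 := by rw [h0]; exact l2Norm_zero
    rw [hΨnorm] at h1
    exact (div_pos hZ'pos hZ).ne' h1
  -- `Φ = Mcl (box Gaussian)`
  have hΦeq : Mcl *ᵥ embed Box (fun x => (((gaussianFunction 1 x / zBox Box : ℝ)) : ℂ)) lab₀ = Φ := by
    rw [hMcl.mulVec_embed, hΦ]; rfl
  -- (1) actual vs `MF Φ`
  have h1 : l2Norm (MF *ᵥ (Mcl *ᵥ ΨGR) - MF *ᵥ Φ) ≤ ε₁ := by
    rw [← Matrix.mulVec_sub, l2Norm_mulVec_of_mem_unitaryGroup hMFU, ← hΦeq, ← Matrix.mulVec_sub,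
      l2Norm_mulVec_of_mem_unitaryGroup hMclU]
    exact hε₁
  -- (2) `MF Φ` vs `multiQFT Φ`
  have hsupp : SuppIn PF Φ := by
    intro z hz
    rw [hΦ, phiState, embed, Finset.sum_apply]
    refine sum_eq_zero fun x hx => ?_
    have hne' : z ≠ κc (lab₀ x) := fun h => hz (h ▸ hPF x hx)
    rw [Pi.smul_apply, basisState_apply, Function.comp_apply, if_neg hne', smul_zero]
  have h2 : l2Norm (MF *ᵥ Φ - multiQFT S *ᵥ Φ) ≤ εF := by
    have := hMF Φ hsupp; rwa [hΦunit, mul_one] at this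
  -- (3) `multiQFT Φ` vs `Ω = multiQFT Ψ̂`
  have hU : multiQFT S ∈ Matrix.unitaryGroup (QReg W) ℂ := multiQFT_mem_unitaryGroup
  have h3 : l2Norm (multiQFT S *ᵥ Φ - Ω) ≤ 2 * (4 * C) := by
    rw [hΩ, omegaState, ← hΨ, ← Matrix.mulVec_sub, l2Norm_mulVec_of_mem_unitaryGroup hU]
    -- `‖Φ − Ψ̂‖ ≤ ‖Φ − Ψ‖ + ‖Ψ − Ψ̂‖ = d + |‖Ψ‖ − 1| ≤ 2d`
    have hl : l2 Ψ ≠ 0 := (l2_pos hΨne).ne'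
    have hnn : l2Norm (Ψ - normalize Ψ) = |l2Norm Ψ - 1| := by
      have hrepr : Ψ - normalize Ψ = ((1 - (l2 Ψ)⁻¹ : ℝ)) • Ψ := by
        rw [QState.normalize, sub_smul, one_smul]
      rw [hrepr]
      change l2 (((1 - (l2 Ψ)⁻¹ : ℝ)) • Ψ) = |l2 Ψ - 1|
      rw [l2_smul]
      have hpos := l2_pos hΨne
      rw [show |1 - (l2 Ψ)⁻¹| * l2 Ψ = |(1 - (l2 Ψ)⁻¹) * l2 Ψ| by rw [abs_mul, abs_of_pos hpos], sub_mul,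
        inv_mul_cancel₀ hl, one_mul]
    have habs : |l2Norm Ψ - 1| ≤ l2Norm (Φ - Ψ) := by
      rw [← hΦunit, abs_sub_comm]
      simp only [l2Norm]
      rw [WithLp.toLp_sub]
      exact abs_norm_sub_norm_le _ _
    calc l2Norm (Φ - normalize Ψ) ≤ l2Norm (Φ - Ψ) + l2Norm (Ψ - normalize Ψ) := l2Norm_sub_le _ _ _
      _ ≤ l2Norm (Φ - Ψ) + l2Norm (Φ - Ψ) := by rw [hnn]; exact add_le_add le_rfl habs
      _ ≤ 4 * C + 4 * C := add_le_add hd hd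
      _ = 2 * (4 * C) := by ring
  -- total distance
  have hdist : l2Norm (MF *ᵥ (Mcl *ᵥ ΨGR) - Ω) ≤ ε₁ + εF + 8 * C := by
    calc l2Norm (MF *ᵥ (Mcl *ᵥ ΨGR) - Ω)
        ≤ l2Norm (MF *ᵥ (Mcl *ᵥ ΨGR) - MF *ᵥ Φ) + l2Norm (MF *ᵥ Φ - Ω) := l2Norm_sub_le _ _ _
      _ ≤ ε₁ + (l2Norm (MF *ᵥ Φ - multiQFT S *ᵥ Φ) + l2Norm (multiQFT S *ᵥ Φ - Ω)) := add_le_add h1 (l2Norm_sub_le _ _ _)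
      _ ≤ ε₁ + (εF + 2 * (4 * C)) := add_le_add le_rfl (add_le_add h2 h3)
      _ = ε₁ + εF + 8 * C := by ring
  -- unit vectors
  have hΨunit : l2 (MF *ᵥ (Mcl *ᵥ ΨGR)) = 1 := by
    change l2Norm (MF *ᵥ (Mcl *ᵥ ΨGR)) = 1
    rw [l2Norm_mulVec_of_mem_unitaryGroup hMFU, l2Norm_mulVec_of_mem_unitaryGroup hMclU, hΨGR]
  have hΩunit : l2 Ω = 1 := by
    rw [hΩ, omegaState, l2_unitary_mulVec hU, l2_normalize]
    rw [← hΨ]; exact hΨne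
  -- BBBV: the two probabilities are within twice the distance
  have hmeas := abs_sum_filter_normSq_sub_le hΨunit hΩunit (fun z => dec (readS S z) ∈ A)
  rw [hΩ, prob_ideal_eq hR hne hZ'pos dec A] at hmeas
  -- the ideal probability, through `lemma_3_14_ideal_aux`
  have hbr : ∀ y ∈ Box.image yOf, l2 (normalize (branchVec Λ e (2 ^ κ) Box y) - normalize (thetaOne Λ e (2 ^ κ))) ≤ η₀ := by
    intro y hy
    obtain ⟨x, hx, rfl⟩ := mem_image.1 hy
    exact l2_normalize_branchVec_sub_normalize_thetaOne_le Λ e (2 ^ κ) hsvΛ (hBox x hx) (hY x hx) hδ.le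
  have hbrne : ∀ y ∈ Box.image yOf, branchVec Λ e (2 ^ κ) Box y ≠ 0 := by
    intro y hy h0
    obtain ⟨x, hx, rfl⟩ := mem_image.1 hy
    have h00 := congrFun h0 0
    simp only [branchVec, Pi.zero_apply, Complex.ofReal_eq_zero] at h00
    have hn0 : ‖(0 : V)‖ < Real.sqrt n := by
      rw [norm_zero]; exact Real.sqrt_pos.2 (by rw [hn]; exact_mod_cast Module.finrank_pos)
    have hyB : (0 : V) + yOf x ∈ Box := hBox x hx 0 Λ.zero_mem hn0
    have hle := gaussianFunction_le_branchAmp Λ e (2 ^ κ) (s := 0) hyB (0 : Λ)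
      (by rw [reprPt_zero, Submodule.coe_zero, smul_zero, add_zero, zero_add, sub_self])
    linarith [gaussianFunction_pos 1 ((0 : V) + yOf x)]
  have hη := l2_psiTilde_sub_le (e := e) hZ'pos hη₀0 hbrne hbr
  have hideal := lemma_3_14_ideal_aux Λ e (2 ^ κ) hsv hdec (l2_gBranch hZ'pos) (l2_psiTilde hZ'pos) hη A
  -- assemble
  have h2d : 2 * l2 (MF *ᵥ (Mcl *ᵥ ΨGR) - omegaState Λ e S base enc Box yOf) ≤ 2 * (ε₁ + εF + 8 * C) := by
    change 2 * l2Norm (MF *ᵥ (Mcl *ᵥ ΨGR) - Ω) ≤ _; linarith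
  rw [← hn] at hideal
  calc |∑ z ∈ univ.filter (fun z => dec (readS S z) ∈ A), ‖(MF *ᵥ (Mcl *ᵥ ΨGR)) z‖ ^ 2 -
        ((discreteGaussian (primalLattice Λ e (2 ^ κ)) (Real.sqrt 2)⁻¹ 0).toOuterMeasure
          {x : primalLattice Λ e (2 ^ κ) | (x : V) ∈ A}).toReal|
      ≤ |∑ z ∈ univ.filter (fun z => dec (readS S z) ∈ A), ‖(MF *ᵥ (Mcl *ᵥ ΨGR)) z‖ ^ 2 -
          ∑ p ∈ univ.filter (fun p : (Fin m → ZMod (2 ^ κ)) × (Box.image yOf) => dec p.1 ∈ A),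
            ‖((QFTZMod.qftMatrix (Fin m) (2 ^ κ) ⊗ₖ (1 : Matrix (Box.image yOf) (Box.image yOf) ℂ)) *ᵥ
              psiTilde κ Λ e Box yOf) p‖ ^ 2| +
        |∑ p ∈ univ.filter (fun p : (Fin m → ZMod (2 ^ κ)) × (Box.image yOf) => dec p.1 ∈ A),
            ‖((QFTZMod.qftMatrix (Fin m) (2 ^ κ) ⊗ₖ (1 : Matrix (Box.image yOf) (Box.image yOf) ℂ)) *ᵥ
              psiTilde κ Λ e Box yOf) p‖ ^ 2 -
          ((discreteGaussian (primalLattice Λ e (2 ^ κ)) (Real.sqrt 2)⁻¹ 0).toOuterMeasure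
            {x : primalLattice Λ e (2 ^ κ) | (x : V) ∈ A}).toReal| := abs_sub_le _ _ _
    _ ≤ 2 * l2 (MF *ᵥ (Mcl *ᵥ ΨGR) - omegaState Λ e S base enc Box yOf) + (2 * η₀ + 9 * (2⁻¹ : ℝ) ^ n) :=
        add_le_add hmeas hideal
    _ ≤ 2 * (ε₁ + εF + 8 * C) + (2 * η₀ + 9 * (2⁻¹ : ℝ) ^ n) := add_le_add h2d le_rfl
    _ = _ := by ring

open Classical in
/-- **The law of the quantum part from the data `(L, (Lⱼ), R = 2^κ)`**: `law_bound` for `Λ = L*/R` with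
its basis `L*ⱼ/R` (`dualOver`, `dualOverZBasis`), the hypotheses `λ₁(RL) > 2√n` and the decoder stated on
`L` and its basis (as in `Regev2009.lemma_3_14_ideal_of_basis`), and the conclusion on `D_{L,1/√2}`.
[cite: Regev2009, Lemma 3.14] -/
theorem law_bound_of_basis [FiniteDimensional ℝ V] [MeasurableSpace V] [BorelSpace V] [Nontrivial V]
    (L : Submodule ℤ V) [DiscreteTopology L] [IsZLattice ℝ L] (bL : Basis (Fin m) ℤ L) [NeZero (2 ^ κ : ℕ)] [DecidablePred Good]
    (hH : FibreHyps (dualOver (2 ^ κ) L bL) (dualOverZBasis (2 ^ κ) L bL) (2 ^ κ) Box yOf sOf Good)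
    (hR : RegHyps S base enc Box yOf sOf Good lab₀ κc) (hne : Box.Nonempty)
    -- lattice hypotheses
    (hsvΛ : ∀ z ∈ scaledLattice (dualOver (2 ^ κ) L bL) (2 ^ κ), ‖z‖ < 2 * Real.sqrt (finrank ℝ V) → z = 0)
    (hL : ∀ x ∈ L, ‖((2 ^ κ : ℕ) : ℝ) • x‖ < 2 * Real.sqrt (finrank ℝ V) → x = 0)
    {dec : (Fin m → ZMod (2 ^ κ)) → V}
    (hdec : ∀ t : Fin m → ZMod (2 ^ κ), ∀ x ∈ L,
      ‖∑ j, ((t j).val : ℝ) • ((bL j : L) : V) + ((2 ^ κ : ℕ) : ℝ) • x‖ < Real.sqrt (finrank ℝ V) →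
        dec t = ∑ j, ((t j).val : ℝ) • ((bL j : L) : V) + ((2 ^ κ : ℕ) : ℝ) • x)
    {B Y C : ℝ} (hBox : ∀ x ∈ Box, BoxCoversShort (dualOver (2 ^ κ) L bL) Box (yOf x)) (hY : ∀ x ∈ Box, ‖yOf x‖ ≤ Y)
    (hB : ∀ x ∈ Box, ∀ x' ∈ Box, ‖x - yOf x'‖ ≤ B) (hδ : π * (2 * Real.sqrt (finrank ℝ V) * Y + Y ^ 2) < 1)
    (hC : Real.exp (2 * π * B * Y) * (2⁻¹ : ℝ) ^ finrank ℝ V ≤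
      C * ((1 - π * (2 * Real.sqrt (finrank ℝ V) * Y + Y ^ 2)) * (1 - banaConst ^ finrank ℝ V) * (1 - (4⁻¹ : ℝ) ^ finrank ℝ V)))
    (hC2 : C ≤ 1 / 2) (hC0 : 0 ≤ C)
    -- machine hypotheses
    {ΨGR : QReg W → ℂ} (hΨGR : l2Norm ΨGR = 1) {ε₁ : ℝ}
    (hε₁ : l2Norm (ΨGR - embed Box (fun x => (((gaussianFunction 1 x / zBox Box : ℝ)) : ℂ)) lab₀) ≤ ε₁)
    {Mcl : Matrix (QReg W) (QReg W) ℂ} (hMcl : IsBasisMap Mcl κc) (hMclU : Mcl ∈ Matrix.unitaryGroup (QReg W) ℂ)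
    {MF : Matrix (QReg W) (QReg W) ℂ} (hMFU : MF ∈ Matrix.unitaryGroup (QReg W) ℂ) {PF : Set (QReg W)} {εF : ℝ}
    (hMF : ImplOn PF MF (multiQFT S) εF) (hPF : ∀ x ∈ Box, κc (lab₀ x) ∈ PF)
    (A : Set V) :
    |∑ z ∈ univ.filter (fun z => dec (readS S z) ∈ A), ‖(MF *ᵥ (Mcl *ᵥ ΨGR)) z‖ ^ 2 -
        ((discreteGaussian L (Real.sqrt 2)⁻¹ 0).toOuterMeasure {x : L | (x : V) ∈ A}).toReal| ≤
      2 * (ε₁ + εF + 8 * C) +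
        2 * (Real.sqrt (2 * (π * (2 * Real.sqrt (finrank ℝ V) * Y + Y ^ 2) + banaConst ^ finrank ℝ V + 4⁻¹ ^ finrank ℝ V)) +
          2 * (2⁻¹ : ℝ) ^ finrank ℝ V) + 9 * (2⁻¹ : ℝ) ^ finrank ℝ V := by
  have hsv : ShortVectorsTrivial (dualOver (2 ^ κ) L bL) (dualOverZBasis (2 ^ κ) L bL) (2 ^ κ) := by
    intro z hz hzn
    rw [primalLattice_dualOver] at hz
    obtain ⟨x, hx, rfl⟩ := (mem_scaledLattice L).1 hz
    rw [hL x hx hzn, smul_zero]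
  have hdec' : IsDecoder (dualOver (2 ^ κ) L bL) (dualOverZBasis (2 ^ κ) L bL) (2 ^ κ) dec := by
    intro t z hz hlt
    rw [reprPt_dualOver] at hlt ⊢
    rw [primalLattice_dualOver] at hz
    obtain ⟨x, hx, rfl⟩ := (mem_scaledLattice L).1 hz
    exact hdec t x hx hlt
  have h := law_bound hH hR hne hsvΛ hsv hdec' hBox hY hB hδ hC hC2 hC0 hΨGR hε₁ hMcl hMclU hMFU hMF hPF A
  have hs : (0 : ℝ) < (Real.sqrt 2)⁻¹ := inv_pos.2 (Real.sqrt_pos.2 two_pos)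
  rw [toReal_toOuterMeasure_discreteGaussian_eq _ hs] at h
  rw [toReal_toOuterMeasure_discreteGaussian_eq _ hs]
  have hset : ((primalLattice (dualOver (2 ^ κ) L bL) (dualOverZBasis (2 ^ κ) L bL) (2 ^ κ) : Submodule ℤ V) : Set V) = (L : Set V) := by
    rw [primalLattice_dualOver]
  rwa [hset] at h

end QPart

end Regev2009

end Literature.Algebra.EuclideanLattices
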